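import Literature.AlgebraicGeometry.Resolution.ExceptionalCurveIntersectionSymmetry
import Literature.AlgebraicGeometry.Resolution.StalkIdealLemmas
import Literature.AlgebraicGeometry.Resolution.MarkedIdealsLemmas
import Literature.AlgebraicGeometry.Motives.CartierDivisorIdealSheaf
import HarnessLib

/-!
# Ideal sheaves of effective Cartier divisors: `𝒪(−D−E) = 𝒪(−D)𝒪(−E)`, `𝒪(−div g) = (g)`, and
# `𝒪(−H) ∩ 𝓘_E = 𝒪(−H)𝓘_E` for `E ⊄ H` (Görtz–Wedhorn I, Remark 11.27, Thm. 11.40)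

Topic: `Literature/AlgebraicGeometry/Resolution`.  PROVED, fact-free, definition-free.  Three pieces of the dictionary
"effective Cartier divisors ↔ invertible ideal sheaves" (U. Görtz, T. Wedhorn, *Algebraic Geometry I*, 2nd ed. 2020,
Remark 11.27 with (11.12): the closed subscheme of an effective divisor, `D ∩ U_i = V(f_i)`; (11.9): the sum
`(U_i, f_i) + (V_j, g_j) = (U_i ∩ V_j, f_i g_j)`; Thm. 11.40: Cartier versus Weil divisors on locally factorial
schemes) for the tree's `CartierDivisor.IsEffective.idealSheaf` (`Motives/CartierDivisorIdealSheaf`):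

* **`idealSheaf_add_of_isEffective`** — `𝒪_X(−(D+E)) = 𝒪_X(−D)·𝒪_X(−E)` as ideal sheaves (on an affine open
  inside charts of both, `(t) · (t') = (t t')`);
* **`ideal_idealSheaf_principal_eq_span`** — for a global function `g ∈ Γ(X, 𝒪_X)` with `g ≠ 0` in `K(X)`, the
  ideal sheaf of the (effective) principal divisor `div g` has sections `(g|_V)` on every affine open `V`;
* **`inf_primeDivisorIdeal_le_mul_of_notMem_support`** — for an invertible ideal sheaf `𝓗` and a point `η` with
  `η ∉ V(𝓗)`, `𝓗 ∩ 𝓘_η ⊆ 𝓗·𝓘_η` (`𝓘_η = primeDivisorIdeal η` the ideal of `cl{η}`; stalkwise `(h) ∩ 𝔭 = h𝔭` for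
  `h ∉ 𝔭` prime).

These serve the "moving" of an exceptional curve `E` by a principal divisor `(g) = aE + H` in the computation of
`(E·E)` (Lipman 1969, §13–§14).

## References
* U. Görtz, T. Wedhorn, *Algebraic Geometry I* (2nd ed., 2020), (11.9), Remark 11.27, (11.12), Thm. 11.40. [GortzWedhorn2020]
* J. Lipman, Publ. Math. IHÉS 36 (1969), §14 (p. 224). [Lipman1969]
-/

noncomputable section

open CategoryTheory AlgebraicGeometry TopologicalSpace IsLocalRing Opposite
open Literature.AlgebraicGeometry.Motives Literature.AlgebraicGeometry.Motives.RatFn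
open Scheme.IdealSheafData

universe u

namespace Literature.AlgebraicGeometry.Resolution

variable {X : Scheme.{u}} [IsIntegral X]

/-! ## §1 `𝒪(−D−E) = 𝒪(−D)𝒪(−E)` -/

/-- **`𝒪_X(−(D+E)) = 𝒪_X(−D)·𝒪_X(−E)`** for effective Cartier divisors `D`, `E` on an integral scheme: the ideal
sheaf of the sum `(U_i ∩ V_j, f_i g_j)` is the product of the ideal sheaves (both are `(t t')` on an affine open
inside `U_i ∩ V_j` on which `f_i`, `g_j` are the sections `t`, `t'`).
[cite: GortzWedhorn2020, Section (11.9) and Remark 11.27 (pp. 374, 378)] -/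
theorem idealSheaf_add_of_isEffective {D E : CartierDivisor X} (hD : D.IsEffective) (hE : E.IsEffective) :
    (hD.add hE).idealSheaf = hD.idealSheaf * hE.idealSheaf := by
  refine Scheme.IdealSheafData.ext_of_iSup_eq_top
    (fun p : {p : X × X.affineOpens // ∃ (hy : p.1 ∈ (p.2 : X.Opens)) (i : D.ι) (j : E.ι) (t t' : Γ(X, p.2)),
      (p.2 : X.Opens) ≤ D.U i ∧ (p.2 : X.Opens) ≤ E.U j ∧ secFn hy t = D.f i ∧ secFn hy t' = E.f j} => p.1.2)
    ?_ ?_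
  · refine top_le_iff.mp fun y _ => ?_
    obtain ⟨W, hyW, i, j, t, t', hWi, hWj, ht, ht', -, -, -⟩ := hD.exists_ideal_sup_eq_span hE y
    exact Opens.mem_iSup.mpr ⟨⟨(y, W), hyW, i, j, t, t', hWi, hWj, ht, ht'⟩, hyW⟩
  · rintro ⟨⟨y, W⟩, hy, i, j, t, t', hWi, hWj, ht, ht'⟩
    change (D + E).sectionIdeal W = (hD.idealSheaf * hE.idealSheaf).ideal W
    have hWij : (W : X.Opens) ≤ (D + E).U (i, j) := le_inf hWi hWj
    have htt' : secFn hy (t * t') = (D + E).f (i, j) := by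
      rw [secFn_mul, ht, ht']
      rfl
    rw [ideal_mul, Pi.mul_apply, CartierDivisor.IsEffective.ideal_idealSheaf,
      CartierDivisor.IsEffective.ideal_idealSheaf, CartierDivisor.sectionIdeal_eq_span hy hWi ht,
      CartierDivisor.sectionIdeal_eq_span hy hWj ht', CartierDivisor.sectionIdeal_eq_span hy hWij htt',
      Ideal.span_singleton_mul_span_singleton]

/-! ## §2 The ideal sheaf of the principal divisor of a global function -/

/-- The principal divisor of a GLOBAL function `g ∈ Γ(X, 𝒪_X)` (`g ≠ 0` in `K(X)`) is effective.
[cite: GortzWedhorn2020, Section (11.9) (p. 374)] -/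
theorem isEffective_principal_secFn (γ : Γ(X, ⊤))
    (hγ : secFn (show genericPoint X ∈ (⊤ : X.Opens) from trivial) γ ≠ 0) :
    (CartierDivisor.principal _ hγ).IsEffective :=
  fun _ y _ => isRegularAt_secFn (show genericPoint X ∈ (⊤ : X.Opens) from trivial)
    (show y ∈ (⊤ : X.Opens) from trivial) γ

/-- **`𝒪_X(−div g) = (g)`**: for a global function `g ∈ Γ(X, 𝒪_X)`, `g ≠ 0` in `K(X)`, the ideal sheaf of the
effective principal divisor `div g = (X, g)` has sections `(g|_V)` over every affine open `V`
(`D ∩ U = V(g)` with the single chart `U = X`). [cite: GortzWedhorn2020, Remark 11.27 and (11.12) (pp. 378–379)] -/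
theorem ideal_idealSheaf_principal_eq_span (γ : Γ(X, ⊤))
    (hγ : secFn (show genericPoint X ∈ (⊤ : X.Opens) from trivial) γ ≠ 0) (V : X.affineOpens) :
    (isEffective_principal_secFn γ hγ).idealSheaf.ideal V =
      Ideal.span {X.presheaf.map (homOfLE (le_top : (V : X.Opens) ≤ ⊤)).op γ} := by
  rcases (V : X.Opens).1.eq_empty_or_nonempty with h | h
  · have hbot : (V : X.Opens) = ⊥ := SetLike.ext' h
    haveI : Subsingleton Γ(X, (V : X.Opens)) :=
      CommRingCat.subsingleton_of_isTerminal (X.sheaf.isTerminalOfEqEmpty hbot)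
    apply Ideal.ext
    intro x
    rw [Subsingleton.elim x 0]
    exact ⟨fun _ => Ideal.zero_mem _, fun _ => Ideal.zero_mem _⟩
  · obtain ⟨y, hy⟩ := h
    have hy' : y ∈ (V : X.Opens) := hy
    rw [CartierDivisor.IsEffective.ideal_idealSheaf]
    refine CartierDivisor.sectionIdeal_eq_span (D := CartierDivisor.principal _ hγ) (i := PUnit.unit) hy'
      (le_top : (V : X.Opens) ≤ ⊤) ?_
    rw [secFn_map (le_top : (V : X.Opens) ≤ ⊤) hy' γ]
    rfl

/-! ## §3 `𝓗 ∩ 𝓘_E = 𝓗 𝓘_E` for an invertible `𝓗` not containing `E` -/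

omit [IsIntegral X] in
/-- **`𝓗 ∩ 𝓘_η ⊆ 𝓗·𝓘_η` for an invertible ideal sheaf `𝓗` with `η ∉ V(𝓗)`** (`𝓘_η = primeDivisorIdeal η`):
stalkwise at `x`, if `η ⤳̸ x` then `(𝓘_η)_x = (1)`; if `η ⤳ x` then `(𝓘_η)_x = 𝔭_η` is prime and `𝓗_x = (h)` with
`h ∉ 𝔭_η` (the image of `h` in `𝒪_{X,η}` generates `𝓗_η = (1)`), so `(h) ∩ 𝔭_η = h·𝔭_η`. This is the "no common
component" hypothesis of the peeling sequence for the moving part `H` of a principal divisor `(g) = aE + H`.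
[cite: GortzWedhorn2020, Thm. 11.40] -/
theorem inf_primeDivisorIdeal_le_mul_of_notMem_support (𝓗 : X.IdealSheafData) (hH : IsEffectiveCartier 𝓗)
    {η : X} (hη : η ∉ 𝓗.support) :
    𝓗 ⊓ primeDivisorIdeal η ≤ 𝓗 * primeDivisorIdeal η := by
  refine le_of_forall_stalkIdeal_le fun x => ?_
  rw [stalkIdeal_inf, stalkIdeal_mul]
  by_cases hx : η ⤳ x
  · rw [stalkIdeal_primeDivisorIdeal hx, ← span_germ_cartierGen 𝓗 hH x]
    set h := X.presheaf.germ (CartierDivisor.cartierChart 𝓗 hH x : X.Opens) x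
      (CartierDivisor.mem_cartierChart 𝓗 hH x) (CartierDivisor.cartierGen 𝓗 hH x) with hh
    -- `h ∉ 𝔭_η`: its image in `𝒪_{X,η}` generates `𝓗_η = (1)`
    have hnot : h ∉ primeOfSpecializes hx := by
      intro hmem
      have hmap := stalkIdeal_map_stalkSpecializes 𝓗 hx
      rw [← span_germ_cartierGen 𝓗 hH x, ← hh, Ideal.map_span, Set.image_singleton,
        stalkIdeal_eq_top_of_not_mem_support hη, Ideal.span_singleton_eq_top] at hmap
      have hmem' : (X.presheaf.stalkSpecializes hx).hom h ∈ maximalIdeal (X.presheaf.stalk η) := hmem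
      exact (mem_maximalIdeal _).mp hmem' hmap
    rintro z ⟨hzH, hzP⟩
    rw [SetLike.mem_coe, Ideal.mem_span_singleton'] at hzH
    obtain ⟨r, rfl⟩ := hzH
    have hr : r ∈ primeOfSpecializes hx := by
      haveI : (primeOfSpecializes hx).IsPrime := Ideal.IsPrime.comap _
      rcases (Ideal.IsPrime.mem_or_mem ‹_› (by rw [mul_comm] at hzP; exact hzP)) with h1 | h1
      · exact absurd h1 hnot
      · exact h1
    exact mul_comm h r ▸ Ideal.mul_mem_mul (Ideal.mem_span_singleton_self h) hr
  · rw [stalkIdeal_primeDivisorIdeal_eq_top hx, inf_top_eq, Ideal.mul_top]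

end Literature.AlgebraicGeometry.Resolution

end
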